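import Literature.Geometry.Riemannian.PullbackFamilyDerivative
import Literature.Geometry.Riemannian.RicciFlow
import Literature.Analysis.Calculus.SeeleyExtension
import Mathlib.Analysis.SpecialFunctions.SmoothTransition
import HarnessLib

/-!
# Smooth extension in time of families of functions and of Riemannian metrics

A family of Riemannian metrics `h s`, `s ∈ [0, T]`, on a compact manifold `M` which is `C^∞` on
`M × [0, T]` in the sense of `IsContMDiffFamilyOn` (one-sided derivatives at the endpoints) is
the restriction of a family of Riemannian metrics `C^∞` on all of `M × ℝ`
(`exists_isContMDiffFamilyOn_extension`); similarly a scalar family `Q : ℝ → M → ℝ` smooth on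
`M × [0, T]` extends smoothly to `M × ℝ` (`exists_contMDiff_timeExtension_fun`). This is the
standard reduction of parabolic problems on `M × [0, T]` to problems with coefficients defined
for all times.

## The argument

* Seeley's linear extension operator (`Literature.Analysis.Calculus.Seeley.extend`,
  [Seeley1964]) acts in the time variable only, fibre by fibre (`timeExtendFun`,
  `timeExtendBilin`); since it is a locally finite sum of reflections `t ↦ -2^k t` with fixed
  weights, smoothness on `M × [0, ε)` passes to smoothness on `M × (-∞, ε)` — read in a chart of
  `M` and in a trivialization of the bundle of bilinear forms this is Seeley's theorem with
  parameters (`Seeley.contDiffOn_extend`). Two applications (at `t = 0` and, after time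
  reversal, at `t = T`) give a two-sided extension (`exists_contMDiff_timeExtension_bilin`),
  which stays symmetric.
* Positive definiteness is an open condition: by compactness of
  `K × [-1, T + 1] × (unit sphere of the model space)` chart by chart, the extended forms are
  positive definite for `t ∈ (-δ, T + δ)` (`exists_pos_posDef_of_contMDiff`).
* A time cutoff `χ` equal to `1` on `[0, T]` and supported in `(-δ, T + δ)` blends the extension
  with the fixed metric `h 0`: `χ B + (1 - χ) h 0` is Riemannian for all times and smooth.

## References

* R. T. Seeley, *Extension of `C^∞` functions defined in a half space*, Proc. Amer. Math. Soc. 15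
  (1964), 625–626 (the Theorem). [cite: Seeley1964, Theorem]
* P. Topping, *Lectures on the Ricci flow*, LMS Lecture Note Series 325, CUP 2006, §1.2.3
  (smooth families of metrics on `M × [0, T]`).
-/

noncomputable section

open Bundle Set Filter Function
open scoped Manifold ContDiff Topology

namespace Literature.Geometry.Riemannian

open Literature.Analysis.Calculus Lorentzian Lorentzian.PseudoRiemannianMetric

universe u v w

variable {E : Type*} [NormedAddCommGroup E] [NormedSpace ℝ E] {H : Type*} [TopologicalSpace H]
  {I : ModelWithCorners ℝ E H} {M : Type*} [TopologicalSpace M] [ChartedSpace H M]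
  [IsManifold I ∞ M]

/-! ### A congruence property of Seeley's operator -/

section SeeleyCongr

variable {E₁ E₂ F : Type*} [NormedAddCommGroup E₁] [NormedSpace ℝ E₁] [NormedAddCommGroup E₂]
  [NormedSpace ℝ E₂] [NormedAddCommGroup F] [NormedSpace ℝ F]

/-- Seeley's extension at `(t, e₁)` only depends on the one-variable function `s ↦ f (s, e₁)`:
two data with the same time profile have the same extension. [cite: Seeley1964, Theorem] -/
theorem seeley_extend_congr {δ : ℝ} {f : ℝ × E₁ → F} {f' : ℝ × E₂ → F} {e₁ : E₁} {e₂ : E₂}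
    (hff' : ∀ s, f (s, e₁) = f' (s, e₂)) (t : ℝ) :
    Seeley.extend δ f (t, e₁) = Seeley.extend δ f' (t, e₂) := by
  unfold Seeley.extend Seeley.term
  simp only [Seeley.scale_apply, hff']

end SeeleyCongr

/-! ### Scalar families -/

section Scalar

/-- **Seeley's extension in time of a scalar family**, fibre by fibre: `s ↦ Q s x` extended across
`s = 0` using its values on `[0, ε)`. [cite: Seeley1964, Theorem] -/
def timeExtendFun (ε : ℝ) (Q : ℝ → M → ℝ) (t : ℝ) (x : M) : ℝ :=
  Seeley.extend (E' := Unit) (F := ℝ) ε (fun p : ℝ × Unit ↦ Q p.1 x) (t, ())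

omit [TopologicalSpace M] [ChartedSpace H M] [IsManifold I ∞ M] in
/-- For `t ≥ 0` the extension is the family itself. [cite: Seeley1964, Theorem] -/
theorem timeExtendFun_of_nonneg {ε : ℝ} (Q : ℝ → M → ℝ) {t : ℝ} (ht : 0 ≤ t) (x : M) :
    timeExtendFun ε Q t x = Q t x :=
  Seeley.extend_of_nonneg (E' := Unit) (F := ℝ) (δ := ε) (f := fun p : ℝ × Unit ↦ Q p.1 x)
    (p := (t, ())) ht

variable [I.Boundaryless]

/-- **The extension of a scalar family `C^∞` on `M × [0, ε)` is `C^∞` on `M × (-∞, ε)`** (read in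
the chart `φ × id` of `M × ℝ` it is the Seeley extension of the chart expression, `C^∞` by
`Seeley.contDiffOn_extend`). [cite: Seeley1964, Theorem] -/
theorem contMDiffOn_timeExtendFun {ε : ℝ} (hε : 0 < ε) {Q : ℝ → M → ℝ}
    (hQ : ContMDiffOn (I.prod 𝓘(ℝ, ℝ)) 𝓘(ℝ, ℝ) ∞ (fun q : M × ℝ ↦ Q q.2 q.1) (univ ×ˢ Ico 0 ε)) :
    ContMDiffOn (I.prod 𝓘(ℝ, ℝ)) 𝓘(ℝ, ℝ) ∞ (fun q : M × ℝ ↦ timeExtendFun ε Q q.2 q.1)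
      (univ ×ˢ Iio ε) := by
  rintro ⟨x₁, t₁⟩ ⟨-, ht₁⟩
  set φ := extChartAt I x₁ with hφ
  -- the chart expression of `Q` on `φ.target × [0, ε)`, in Seeley's variable order
  have key := (contMDiffOn_iff.1 hQ).2 (x₁, 0) (Q 0 x₁)
  have hset : (extChartAt (I.prod 𝓘(ℝ, ℝ)) (x₁, (0 : ℝ))).target ∩
      (extChartAt (I.prod 𝓘(ℝ, ℝ)) (x₁, (0 : ℝ))).symm ⁻¹'
        (univ ×ˢ Ico 0 ε ∩ (fun q : M × ℝ ↦ Q q.2 q.1) ⁻¹'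
          (extChartAt 𝓘(ℝ, ℝ) (Q 0 x₁)).source) = φ.target ×ˢ Ico 0 ε := by
    ext ⟨z, s⟩
    simp only [extChartAt_prod, PartialEquiv.prod_target, PartialEquiv.prod_symm,
      PartialEquiv.prod_coe, extChartAt_model_space_eq_id, PartialEquiv.refl_target,
      PartialEquiv.refl_symm, PartialEquiv.refl_coe, PartialEquiv.refl_source, preimage_univ,
      inter_univ, mem_inter_iff, mem_prod, mem_univ, and_true, mem_preimage, true_and, hφ, id]
  rw [hset] at key
  set F : ℝ × E → ℝ := fun r ↦ Q r.1 (φ.symm r.2) with hF_def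
  have hF : ContDiffOn ℝ ∞ F (Seeley.slab ε φ.target) := by
    have hswap : ContDiff ℝ ∞ (fun r : ℝ × E ↦ ((r.2, r.1) : E × ℝ)) :=
      contDiff_snd.prodMk contDiff_fst
    refine (key.comp hswap.contDiffOn fun r hr ↦ mk_mem_prod hr.2 hr.1).congr fun r _ ↦ ?_
    change F r = extChartAt 𝓘(ℝ, ℝ) (Q 0 x₁)
      ((fun q : M × ℝ ↦ Q q.2 q.1) ((extChartAt (I.prod 𝓘(ℝ, ℝ)) (x₁, (0 : ℝ))).symm (r.2, r.1)))
    rw [Literature.Geometry.Manifold.extChartAt_prod_real_symm_apply]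
    simp only [extChartAt_model_space_eq_id, PartialEquiv.refl_coe, id_eq]
    rfl
  have hext : ContDiffOn ℝ ∞ (Seeley.extend ε F) (Iio ε ×ˢ φ.target) :=
    Seeley.contDiffOn_extend hε (isOpen_extChartAt_target x₁) hF
  have hin : ContMDiffAt (I.prod 𝓘(ℝ, ℝ)) 𝓘(ℝ, ℝ × E) ∞ (fun q : M × ℝ ↦ ((q.2, φ q.1) : ℝ × E))
      (x₁, t₁) :=
    contMDiffAt_snd.prodMk_space
      ((contMDiffAt_extChartAt (x := x₁)).comp (x₁, t₁) contMDiffAt_fst)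
  have hG : ContMDiffAt (I.prod 𝓘(ℝ, ℝ)) 𝓘(ℝ, ℝ) ∞
      (fun q : M × ℝ ↦ Seeley.extend ε F (q.2, φ q.1)) (x₁, t₁) :=
    ContDiffAt.comp_contMDiffAt (f := fun q : M × ℝ ↦ ((q.2, φ q.1) : ℝ × E)) (x := (x₁, t₁))
      (hext.contDiffAt ((isOpen_Iio.prod (isOpen_extChartAt_target x₁)).mem_nhds
        (mk_mem_prod ht₁ (mem_extChartAt_target x₁)))) hin
  refine (hG.congr_of_eventuallyEq ?_).contMDiffWithinAt
  have hev : ∀ᶠ q : M × ℝ in 𝓝 (x₁, t₁), q.1 ∈ (chartAt H x₁).source :=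
    continuousAt_fst.preimage_mem_nhds ((chartAt H x₁).open_source.mem_nhds
      (mem_chart_source H x₁))
  filter_upwards [hev] with q hq
  have hqs : q.1 ∈ φ.source := by rwa [hφ, extChartAt_source]
  change timeExtendFun ε Q q.2 q.1 = Seeley.extend ε F (q.2, φ q.1)
  exact seeley_extend_congr (fun s ↦ by simp only [hF_def, φ.left_inv hqs]) q.2

/-- **Smooth extension in time of a scalar family from `M × [0, T]` to `M × ℝ`.** A family
`Q t x`, `C^∞` on `M × [0, T]` in the within sense, agrees on `[0, T]` with a family `C^∞` on all
of `M × ℝ` (Seeley's extension across `t = 0`, then across `t = T` applied to the time-reversed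
family). [cite: Seeley1964, Theorem] -/
theorem exists_contMDiff_timeExtension_fun {T : ℝ} (hT : 0 < T) {Q : ℝ → M → ℝ}
    (hQ : ContMDiffOn (I.prod 𝓘(ℝ, ℝ)) 𝓘(ℝ, ℝ) ∞ (fun q : M × ℝ ↦ Q q.2 q.1) (univ ×ˢ Icc 0 T)) :
    ∃ Qe : ℝ → M → ℝ, ContMDiff (I.prod 𝓘(ℝ, ℝ)) 𝓘(ℝ, ℝ) ∞ (fun q : M × ℝ ↦ Qe q.2 q.1) ∧
      ∀ t ∈ Icc 0 T, Qe t = Q t := by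
  -- first extension, across `t = 0`
  set Q₁ : ℝ → M → ℝ := timeExtendFun T Q with hQ₁
  have hQ₁Q : ∀ t, 0 ≤ t → Q₁ t = Q t := fun t ht ↦ funext fun x ↦ timeExtendFun_of_nonneg Q ht x
  have hQ₁s : ContMDiffOn (I.prod 𝓘(ℝ, ℝ)) 𝓘(ℝ, ℝ) ∞ (fun q : M × ℝ ↦ Q₁ q.2 q.1) (univ ×ˢ Iio T) :=
    contMDiffOn_timeExtendFun hT (hQ.mono (prod_mono Subset.rfl Ico_subset_Icc_self))
  have hQ₁s' : ContMDiffOn (I.prod 𝓘(ℝ, ℝ)) 𝓘(ℝ, ℝ) ∞ (fun q : M × ℝ ↦ Q₁ q.2 q.1) (univ ×ˢ Ioc 0 T) :=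
    (hQ.mono (prod_mono Subset.rfl Ioc_subset_Icc_self)).congr fun q hq ↦ by
      simp only [hQ₁Q q.2 hq.2.1.le]
  -- second extension, across `t = T`
  set Qr : ℝ → M → ℝ := fun s ↦ Q₁ (T - s) with hQr
  have hflip : ContMDiff (I.prod 𝓘(ℝ, ℝ)) (I.prod 𝓘(ℝ, ℝ)) ∞ (fun q : M × ℝ ↦ (q.1, T - q.2)) :=
    contMDiff_fst.prodMk (((contDiff_const (c := T)).sub contDiff_id).comp_contMDiff contMDiff_snd)
  have hQrs : ContMDiffOn (I.prod 𝓘(ℝ, ℝ)) 𝓘(ℝ, ℝ) ∞ (fun q : M × ℝ ↦ Qr q.2 q.1) (univ ×ˢ Ico 0 T) := by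
    have hmaps : MapsTo (fun q : M × ℝ ↦ (q.1, T - q.2)) (univ ×ˢ Ico 0 T) (univ ×ˢ Ioc 0 T) := by
      rintro ⟨x, s⟩ ⟨-, hs⟩
      exact mk_mem_prod (mem_univ _) ⟨by linarith [hs.2], by linarith [hs.1]⟩
    exact hQ₁s'.comp hflip.contMDiffOn hmaps
  set Q₂ : ℝ → M → ℝ := fun t ↦ timeExtendFun T Qr (T - t) with hQ₂
  have hQ₂Q₁ : ∀ t, t ≤ T → Q₂ t = Q₁ t := by
    intro t ht
    funext x
    simp only [hQ₂]
    rw [timeExtendFun_of_nonneg Qr (by linarith)]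
    show Q₁ (T - (T - t)) x = Q₁ t x
    rw [show T - (T - t) = t by ring]
  refine ⟨Q₂, ?_, fun t ht ↦ by rw [hQ₂Q₁ t ht.2, hQ₁Q t ht.1]⟩
  have h2 : ContMDiffOn (I.prod 𝓘(ℝ, ℝ)) 𝓘(ℝ, ℝ) ∞ (fun q : M × ℝ ↦ Q₂ q.2 q.1) (univ ×ˢ Ioi 0) := by
    have hmaps : MapsTo (fun q : M × ℝ ↦ (q.1, T - q.2)) (univ ×ˢ Ioi 0) (univ ×ˢ Iio T) := by
      rintro ⟨x, t⟩ ⟨-, ht⟩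
      have ht0 : 0 < t := ht
      exact mk_mem_prod (mem_univ _) (show T - t < T by linarith)
    exact (contMDiffOn_timeExtendFun hT hQrs).comp hflip.contMDiffOn hmaps
  have h1 : ContMDiffOn (I.prod 𝓘(ℝ, ℝ)) 𝓘(ℝ, ℝ) ∞ (fun q : M × ℝ ↦ Q₂ q.2 q.1) (univ ×ˢ Iio T) :=
    hQ₁s.congr fun q hq ↦ by simp only [hQ₂Q₁ q.2 (le_of_lt hq.2)]
  rintro ⟨x, t⟩
  rcases lt_or_ge t T with ht | ht
  · exact (h1 (x, t) (mk_mem_prod (mem_univ _) ht)).contMDiffAt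
      ((isOpen_univ.prod isOpen_Iio).mem_nhds (mk_mem_prod (mem_univ _) ht))
  · have ht' : t ∈ Ioi (0 : ℝ) := lt_of_lt_of_le hT ht
    exact (h2 (x, t) (mk_mem_prod (mem_univ _) ht')).contMDiffAt
      ((isOpen_univ.prod isOpen_Ioi).mem_nhds (mk_mem_prod (mem_univ _) ht'))

end Scalar

/-! ### Families of bilinear forms on the tangent spaces -/

section Bilin

/-- **Seeley's extension in time of a family of bilinear forms on the tangent spaces**, fibre by
fibre. [cite: Seeley1964, Theorem] -/
def timeExtendBilin (ε : ℝ)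
    (B : ℝ → Π x : M, TangentSpace I x →L[ℝ] TangentSpace I x →L[ℝ] ℝ) (t : ℝ) (x : M) :
    TangentSpace I x →L[ℝ] TangentSpace I x →L[ℝ] ℝ :=
  Seeley.extend (E' := Unit) (F := E →L[ℝ] E →L[ℝ] ℝ) ε
    (fun p : ℝ × Unit ↦ (B p.1 x : E →L[ℝ] E →L[ℝ] ℝ)) (t, ())

omit [IsManifold I ∞ M] in
/-- For `t ≥ 0` the extension is the family itself. [cite: Seeley1964, Theorem] -/
theorem timeExtendBilin_of_nonneg {ε : ℝ}
    (B : ℝ → Π x : M, TangentSpace I x →L[ℝ] TangentSpace I x →L[ℝ] ℝ) {t : ℝ} (ht : 0 ≤ t)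
    (x : M) : timeExtendBilin ε B t x = B t x :=
  Seeley.extend_of_nonneg (E' := Unit) (F := E →L[ℝ] E →L[ℝ] ℝ) (δ := ε)
    (f := fun p : ℝ × Unit ↦ (B p.1 x : E →L[ℝ] E →L[ℝ] ℝ)) (p := (t, ())) ht

omit [IsManifold I ∞ M] in
/-- Below `t = 0` the extension is, locally, a finite linear combination of values at positive
times. [cite: Seeley1964, Theorem] -/
theorem timeExtendBilin_eq_sum {ε : ℝ} (hε : 0 < ε)
    (B : ℝ → Π x : M, TangentSpace I x →L[ℝ] TangentSpace I x →L[ℝ] ℝ) {t₀ t : ℝ}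
    (ht₀ : t₀ < 0) {K : ℕ} (hK : ε / (-t₀) ≤ 2 ^ K) (ht : t < t₀ / 2) (x : M) :
    timeExtendBilin ε B t x =
      ∑ k ∈ Finset.range K, Seeley.weight ε k t • B (-(2 : ℝ) ^ k * t) x := by
  have h := Seeley.extend_eq_sum_of_lt (E' := Unit) (F := E →L[ℝ] E →L[ℝ] ℝ)
    (f := fun p : ℝ × Unit ↦ (B p.1 x : E →L[ℝ] E →L[ℝ] ℝ)) hε ht₀ hK (p := (t, ())) ht
  rw [timeExtendBilin, h]
  simp only [Seeley.term, Seeley.scale_apply]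
  rfl

omit [IsManifold I ∞ M] in
/-- The extension of a family of symmetric forms is symmetric. [folklore] -/
theorem timeExtendBilin_symm {ε : ℝ} (hε : 0 < ε)
    {B : ℝ → Π x : M, TangentSpace I x →L[ℝ] TangentSpace I x →L[ℝ] ℝ}
    (hB : ∀ t x v w, B t x v w = B t x w v) (t : ℝ) (x : M) (v w : TangentSpace I x) :
    timeExtendBilin ε B t x v w = timeExtendBilin ε B t x w v := by
  rcases le_or_gt 0 t with ht | ht
  · rw [timeExtendBilin_of_nonneg B ht]; exact hB t x v w
  · obtain ⟨K, hK⟩ : ∃ K : ℕ, ε / (-t) ≤ 2 ^ K :=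
      (pow_unbounded_of_one_lt (ε / (-t)) (by norm_num : (1 : ℝ) < 2)).imp fun _ h ↦ h.le
    have htt : t < t / 2 := by linarith
    rw [timeExtendBilin_eq_sum hε B ht hK htt x]
    simp only [_root_.sum_apply, _root_.smul_apply, hB]

variable [I.Boundaryless]

set_option maxSynthPendingDepth 2 in
omit [I.Boundaryless] in
/-- **The extension read in the trivialization of the bundle of bilinear forms is the Seeley
extension of the coordinate expression** (the fibre coordinate maps are linear and Seeley's series
is locally finite). [folklore] -/
theorem continuousLinearMapAt_timeExtendBilin {ε : ℝ} (hε : 0 < ε)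
    (B : ℝ → Π x : M, TangentSpace I x →L[ℝ] TangentSpace I x →L[ℝ] ℝ) (x₁ : M) {x : M}
    (hx : x ∈ (chartAt H x₁).source) (t : ℝ) :
    (trivializationAt (E →L[ℝ] E →L[ℝ] ℝ)
        (fun b : M ↦ TangentSpace I b →L[ℝ] TangentSpace I b →L[ℝ] ℝ) x₁).continuousLinearMapAt ℝ x
        (timeExtendBilin ε B t x) =
      Seeley.extend ε (fun r : ℝ × E ↦ (trivializationAt (E →L[ℝ] E →L[ℝ] ℝ)
        (fun b : M ↦ TangentSpace I b →L[ℝ] TangentSpace I b →L[ℝ] ℝ) x₁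
          ⟨(extChartAt I x₁).symm r.2, B r.1 ((extChartAt I x₁).symm r.2)⟩).2)
        (t, extChartAt I x₁ x) := by
  set e := trivializationAt (E →L[ℝ] E →L[ℝ] ℝ)
    (fun b : M ↦ TangentSpace I b →L[ℝ] TangentSpace I b →L[ℝ] ℝ) x₁ with he
  have hxs : x ∈ (extChartAt I x₁).source := by rwa [extChartAt_source]
  have hxe : x ∈ e.baseSet := by
    rw [he, hom_trivializationAt_baseSet, hom_trivializationAt_baseSet,
      TangentBundle.trivializationAt_baseSet]
    exact ⟨hx, hx, mem_univ _⟩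
  set Fm : ℝ → M → (E →L[ℝ] E →L[ℝ] ℝ) := fun s y ↦ (e ⟨y, B s y⟩).2 with hFm
  have hF : ∀ r : ℝ × E, (e ⟨(extChartAt I x₁).symm r.2, B r.1 ((extChartAt I x₁).symm r.2)⟩).2 =
      Fm r.1 ((extChartAt I x₁).symm r.2) := fun r ↦ rfl
  have hFm_eq : ∀ s, Fm s x = e.continuousLinearMapAt ℝ x (B s x) := fun s ↦
    (e.continuousLinearMapAt_apply_of_mem (R := ℝ) hxe _).symm
  rcases le_or_gt 0 t with ht | ht
  · rw [timeExtendBilin_of_nonneg B ht, Seeley.extend_of_nonneg (p := (t, extChartAt I x₁ x)) ht, hF]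
    change _ = Fm t ((extChartAt I x₁).symm (extChartAt I x₁ x))
    rw [(extChartAt I x₁).left_inv hxs, hFm_eq]
  · obtain ⟨K, hK⟩ : ∃ K : ℕ, ε / (-t) ≤ 2 ^ K :=
      (pow_unbounded_of_one_lt (ε / (-t)) (by norm_num : (1 : ℝ) < 2)).imp fun _ h ↦ h.le
    have htt : t < t / 2 := by linarith
    rw [timeExtendBilin_eq_sum hε B ht hK htt x, Seeley.extend_eq_sum_of_lt hε ht hK
      (p := (t, extChartAt I x₁ x)) htt, map_sum]
    refine Finset.sum_congr rfl fun k _ ↦ ?_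
    rw [map_smul, Seeley.term, hF]
    simp only [Seeley.scale_apply]
    rw [(extChartAt I x₁).left_inv hxs, hFm_eq]

set_option maxSynthPendingDepth 2 in
/-- **Seeley's time extension of a family of bilinear forms `C^∞` on `M × [0, ε)` is `C^∞` on
`M × (-∞, ε)`** (as sections of the bundle of bilinear forms over `M × ℝ`).
[cite: Seeley1964, Theorem] -/
theorem contMDiffOn_timeExtendBilin {ε : ℝ} (hε : 0 < ε)
    {B : ℝ → Π x : M, TangentSpace I x →L[ℝ] TangentSpace I x →L[ℝ] ℝ}
    (hB : ContMDiffOn (I.prod 𝓘(ℝ, ℝ)) (I.prod 𝓘(ℝ, E →L[ℝ] E →L[ℝ] ℝ)) ∞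
      (fun q : M × ℝ ↦ TotalSpace.mk' (E →L[ℝ] E →L[ℝ] ℝ)
        (E := fun b : M ↦ TangentSpace I b →L[ℝ] TangentSpace I b →L[ℝ] ℝ) q.1 (B q.2 q.1))
      (univ ×ˢ Ico 0 ε)) :
    ContMDiffOn (I.prod 𝓘(ℝ, ℝ)) (I.prod 𝓘(ℝ, E →L[ℝ] E →L[ℝ] ℝ)) ∞
      (fun q : M × ℝ ↦ TotalSpace.mk' (E →L[ℝ] E →L[ℝ] ℝ)
        (E := fun b : M ↦ TangentSpace I b →L[ℝ] TangentSpace I b →L[ℝ] ℝ) q.1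
          (timeExtendBilin ε B q.2 q.1)) (univ ×ˢ Iio ε) := by
  rintro ⟨x₁, t₁⟩ ⟨-, ht₁⟩
  set e := trivializationAt (E →L[ℝ] E →L[ℝ] ℝ)
    (fun b : M ↦ TangentSpace I b →L[ℝ] TangentSpace I b →L[ℝ] ℝ) x₁ with he
  set φ := extChartAt I x₁ with hφ
  have hUe : ∀ y ∈ (chartAt H x₁).source, y ∈ e.baseSet := fun y hy ↦ by
    rw [he, hom_trivializationAt_baseSet, hom_trivializationAt_baseSet,
      TangentBundle.trivializationAt_baseSet]
    exact ⟨hy, hy, mem_univ _⟩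
  have hmaps : MapsTo (fun q : M × ℝ ↦ TotalSpace.mk' (E →L[ℝ] E →L[ℝ] ℝ)
      (E := fun b : M ↦ TangentSpace I b →L[ℝ] TangentSpace I b →L[ℝ] ℝ) q.1 (B q.2 q.1))
      ((chartAt H x₁).source ×ˢ Ico 0 ε) e.source := fun q hq ↦ by
    rw [e.mem_source]; exact hUe q.1 hq.1
  have h1 : ContMDiffOn (I.prod 𝓘(ℝ, ℝ)) 𝓘(ℝ, E →L[ℝ] E →L[ℝ] ℝ) ∞
      (fun q : M × ℝ ↦ (e ⟨q.1, B q.2 q.1⟩).2) ((chartAt H x₁).source ×ˢ Ico 0 ε) :=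
    ((e.contMDiffOn_iff hmaps).1 (hB.mono (prod_mono (subset_univ _) Subset.rfl))).2
  have key := (contMDiffOn_iff.1 h1).2 (x₁, 0) ((e ⟨x₁, B 0 x₁⟩).2)
  have hset : (extChartAt (I.prod 𝓘(ℝ, ℝ)) (x₁, (0 : ℝ))).target ∩
      (extChartAt (I.prod 𝓘(ℝ, ℝ)) (x₁, (0 : ℝ))).symm ⁻¹'
        ((chartAt H x₁).source ×ˢ Ico 0 ε ∩ (fun q : M × ℝ ↦ (e ⟨q.1, B q.2 q.1⟩).2) ⁻¹'
          (extChartAt 𝓘(ℝ, E →L[ℝ] E →L[ℝ] ℝ) ((e ⟨x₁, B 0 x₁⟩).2)).source) =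
      (φ.target ∩ φ.symm ⁻¹' (chartAt H x₁).source) ×ˢ Ico 0 ε := by
    ext ⟨z, s⟩
    simp only [extChartAt_prod, PartialEquiv.prod_target, PartialEquiv.prod_symm,
      PartialEquiv.prod_coe, extChartAt_model_space_eq_id, PartialEquiv.refl_target,
      PartialEquiv.refl_symm, PartialEquiv.refl_coe, PartialEquiv.refl_source, preimage_univ,
      inter_univ, mem_inter_iff, mem_prod, mem_univ, and_true, mem_preimage, hφ, id]
    tauto
  have hVt : φ.target ∩ φ.symm ⁻¹' (chartAt H x₁).source = φ.target := by
    refine inter_eq_left.2 fun z hz ↦ ?_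
    rw [mem_preimage, ← extChartAt_source I]
    exact φ.map_target hz
  rw [hset, hVt] at key
  set F : ℝ × E → (E →L[ℝ] E →L[ℝ] ℝ) := fun r ↦ (e ⟨φ.symm r.2, B r.1 (φ.symm r.2)⟩).2
    with hF_def
  have hF : ContDiffOn ℝ ∞ F (Seeley.slab ε φ.target) := by
    have hswap : ContDiff ℝ ∞ (fun r : ℝ × E ↦ ((r.2, r.1) : E × ℝ)) :=
      contDiff_snd.prodMk contDiff_fst
    refine (key.comp hswap.contDiffOn fun r hr ↦ mk_mem_prod hr.2 hr.1).congr fun r _ ↦ ?_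
    change F r = extChartAt 𝓘(ℝ, E →L[ℝ] E →L[ℝ] ℝ) ((e ⟨x₁, B 0 x₁⟩).2)
      ((fun q : M × ℝ ↦ (e ⟨q.1, B q.2 q.1⟩).2)
        ((extChartAt (I.prod 𝓘(ℝ, ℝ)) (x₁, (0 : ℝ))).symm (r.2, r.1)))
    rw [Literature.Geometry.Manifold.extChartAt_prod_real_symm_apply]
    simp only [extChartAt_model_space_eq_id, PartialEquiv.refl_coe, id_eq]
    rfl
  have hext : ContDiffOn ℝ ∞ (Seeley.extend ε F) (Iio ε ×ˢ φ.target) :=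
    Seeley.contDiffOn_extend hε (isOpen_extChartAt_target x₁) hF
  have hin : ContMDiffAt (I.prod 𝓘(ℝ, ℝ)) 𝓘(ℝ, ℝ × E) ∞ (fun q : M × ℝ ↦ ((q.2, φ q.1) : ℝ × E))
      (x₁, t₁) :=
    contMDiffAt_snd.prodMk_space
      ((contMDiffAt_extChartAt (x := x₁)).comp (x₁, t₁) contMDiffAt_fst)
  have hG : ContMDiffAt (I.prod 𝓘(ℝ, ℝ)) 𝓘(ℝ, E →L[ℝ] E →L[ℝ] ℝ) ∞
      (fun q : M × ℝ ↦ Seeley.extend ε F (q.2, φ q.1)) (x₁, t₁) :=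
    ContDiffAt.comp_contMDiffAt (f := fun q : M × ℝ ↦ ((q.2, φ q.1) : ℝ × E)) (x := (x₁, t₁))
      (hext.contDiffAt ((isOpen_Iio.prod (isOpen_extChartAt_target x₁)).mem_nhds
        (mk_mem_prod ht₁ (mem_extChartAt_target x₁)))) hin
  apply ContMDiffAt.contMDiffWithinAt
  rw [contMDiffAt_totalSpace]
  refine ⟨contMDiffAt_fst, ?_⟩
  refine hG.congr_of_eventuallyEq ?_
  have hev : ∀ᶠ q : M × ℝ in 𝓝 (x₁, t₁), q.1 ∈ (chartAt H x₁).source :=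
    continuousAt_fst.preimage_mem_nhds ((chartAt H x₁).open_source.mem_nhds
      (mem_chart_source H x₁))
  filter_upwards [hev] with q hq
  change (e ⟨q.1, timeExtendBilin ε B q.2 q.1⟩).2 = Seeley.extend ε F (q.2, φ q.1)
  rw [← e.continuousLinearMapAt_apply_of_mem (R := ℝ) (hUe q.1 hq) _]
  exact continuousLinearMapAt_timeExtendBilin hε B x₁ hq q.2

/-! #### Linear combinations of smooth maps into the bundle of bilinear forms -/

set_option maxSynthPendingDepth 2 in
omit [I.Boundaryless] in
/-- A smooth linear combination `p ↦ (b p, c p • V p + c' p • W p)` of two maps into the bundle of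
bilinear forms which are `C^n` (within `s` at `p₀`) is `C^n` within `s` at `p₀` (trivializations
are fibrewise linear). [folklore] -/
theorem ContMDiffWithinAt.linear_comb_bilinSection {P : Type*} [TopologicalSpace P] {HP : Type*}
    [TopologicalSpace HP] {EP : Type*} [NormedAddCommGroup EP] [NormedSpace ℝ EP]
    {IP : ModelWithCorners ℝ EP HP} [ChartedSpace HP P] {n : ℕ∞ω} {b : P → M} {c c' : P → ℝ}
    {V W : ∀ p : P, TangentSpace I (b p) →L[ℝ] TangentSpace I (b p) →L[ℝ] ℝ} {s : Set P} {p₀ : P}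
    (hc : ContMDiffWithinAt IP 𝓘(ℝ, ℝ) n c s p₀) (hc' : ContMDiffWithinAt IP 𝓘(ℝ, ℝ) n c' s p₀)
    (hV : ContMDiffWithinAt IP (I.prod 𝓘(ℝ, E →L[ℝ] E →L[ℝ] ℝ)) n
      (fun p ↦ TotalSpace.mk' (E →L[ℝ] E →L[ℝ] ℝ)
        (E := fun x : M ↦ TangentSpace I x →L[ℝ] TangentSpace I x →L[ℝ] ℝ) (b p) (V p)) s p₀)
    (hW : ContMDiffWithinAt IP (I.prod 𝓘(ℝ, E →L[ℝ] E →L[ℝ] ℝ)) n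
      (fun p ↦ TotalSpace.mk' (E →L[ℝ] E →L[ℝ] ℝ)
        (E := fun x : M ↦ TangentSpace I x →L[ℝ] TangentSpace I x →L[ℝ] ℝ) (b p) (W p)) s p₀) :
    ContMDiffWithinAt IP (I.prod 𝓘(ℝ, E →L[ℝ] E →L[ℝ] ℝ)) n
      (fun p ↦ TotalSpace.mk' (E →L[ℝ] E →L[ℝ] ℝ)
        (E := fun x : M ↦ TangentSpace I x →L[ℝ] TangentSpace I x →L[ℝ] ℝ) (b p)
          (c p • V p + c' p • W p)) s p₀ := by
  rw [contMDiffWithinAt_totalSpace] at hV hW ⊢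
  refine ⟨hV.1, ?_⟩
  set e := trivializationAt (E →L[ℝ] E →L[ℝ] ℝ)
    (fun x : M ↦ TangentSpace I x →L[ℝ] TangentSpace I x →L[ℝ] ℝ) (b p₀) with he
  have hev : ∀ᶠ p in 𝓝[s] p₀, b p ∈ e.baseSet :=
    hV.1.continuousWithinAt.preimage_mem_nhdsWithin
      (e.open_baseSet.mem_nhds (FiberBundle.mem_baseSet_trivializationAt' (b p₀)))
  have hlin : ∀ p, b p ∈ e.baseSet →
      (e ⟨b p, c p • V p + c' p • W p⟩).2 = c p • (e ⟨b p, V p⟩).2 + c' p • (e ⟨b p, W p⟩).2 := by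
    intro p hp
    rw [(e.linear ℝ hp).map_add, (e.linear ℝ hp).map_smul, (e.linear ℝ hp).map_smul]
  refine ((hc.smul hV.2).add (hc'.smul hW.2)).congr_of_eventuallyEq ?_ ?_
  · filter_upwards [hev] with p hp using hlin p hp
  · exact hlin p₀ (FiberBundle.mem_baseSet_trivializationAt' (b p₀))

end Bilin

/-! ### Extension of a family of Riemannian metrics -/

section Metric

variable [I.Boundaryless] [FiniteDimensional ℝ E] [T2Space M] [CompactSpace M]

omit [FiniteDimensional ℝ E] [T2Space M] [CompactSpace M] in
/-- **Two-sided smooth extension in time of the bilinear forms of a family of metrics.** A family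
`h` of metrics `C^∞` on `M × [0, T]` (`IsContMDiffFamilyOn`) has its bilinear forms extended to a
family `B` of symmetric bilinear forms `C^∞` on all of `M × ℝ`, equal to `h` on `[0, T]` (Seeley's
extension across `t = 0` and, after time reversal, across `t = T`). [cite: Seeley1964, Theorem] -/
theorem exists_contMDiff_timeExtension_bilin {T : ℝ} (hT : 0 < T)
    {h : ℝ → PseudoRiemannianMetric I ∞ E (TangentSpace I : M → Type _)}
    (hh : IsContMDiffFamilyOn ∞ h (Icc 0 T)) :
    ∃ B : ℝ → Π x : M, TangentSpace I x →L[ℝ] TangentSpace I x →L[ℝ] ℝ,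
      ContMDiff (I.prod 𝓘(ℝ, ℝ)) (I.prod 𝓘(ℝ, E →L[ℝ] E →L[ℝ] ℝ)) ∞
        (fun q : M × ℝ ↦ TotalSpace.mk' (E →L[ℝ] E →L[ℝ] ℝ)
          (E := fun b : M ↦ TangentSpace I b →L[ℝ] TangentSpace I b →L[ℝ] ℝ) q.1 (B q.2 q.1)) ∧
      (∀ t ∈ Icc 0 T, B t = fun x ↦ (h t).val x) ∧ ∀ t x v w, B t x v w = B t x w v := by
  set B₀ : ℝ → Π x : M, TangentSpace I x →L[ℝ] TangentSpace I x →L[ℝ] ℝ := fun t x ↦ (h t).val x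
    with hB₀
  have hB₀s : ContMDiffOn (I.prod 𝓘(ℝ, ℝ)) (I.prod 𝓘(ℝ, E →L[ℝ] E →L[ℝ] ℝ)) ∞
      (fun q : M × ℝ ↦ TotalSpace.mk' (E →L[ℝ] E →L[ℝ] ℝ)
        (E := fun b : M ↦ TangentSpace I b →L[ℝ] TangentSpace I b →L[ℝ] ℝ) q.1 (B₀ q.2 q.1))
      (univ ×ˢ Icc 0 T) := hh
  have hB₀symm : ∀ t x v w, B₀ t x v w = B₀ t x w v := fun t x v w ↦ (h t).symm x v w
  -- first extension
  set B₁ := timeExtendBilin T B₀ with hB₁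
  have hB₁B₀ : ∀ t, 0 ≤ t → B₁ t = B₀ t := fun t ht ↦ funext fun x ↦ timeExtendBilin_of_nonneg B₀ ht x
  have hB₁symm : ∀ t x v w, B₁ t x v w = B₁ t x w v := timeExtendBilin_symm hT hB₀symm
  have hB₁s : ContMDiffOn (I.prod 𝓘(ℝ, ℝ)) (I.prod 𝓘(ℝ, E →L[ℝ] E →L[ℝ] ℝ)) ∞
      (fun q : M × ℝ ↦ TotalSpace.mk' (E →L[ℝ] E →L[ℝ] ℝ)
        (E := fun b : M ↦ TangentSpace I b →L[ℝ] TangentSpace I b →L[ℝ] ℝ) q.1 (B₁ q.2 q.1))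
      (univ ×ˢ Iio T) :=
    contMDiffOn_timeExtendBilin hT (hB₀s.mono (prod_mono Subset.rfl Ico_subset_Icc_self))
  have hB₁s' : ContMDiffOn (I.prod 𝓘(ℝ, ℝ)) (I.prod 𝓘(ℝ, E →L[ℝ] E →L[ℝ] ℝ)) ∞
      (fun q : M × ℝ ↦ TotalSpace.mk' (E →L[ℝ] E →L[ℝ] ℝ)
        (E := fun b : M ↦ TangentSpace I b →L[ℝ] TangentSpace I b →L[ℝ] ℝ) q.1 (B₁ q.2 q.1))
      (univ ×ˢ Ioc 0 T) :=
    (hB₀s.mono (prod_mono Subset.rfl Ioc_subset_Icc_self)).congr fun q hq ↦ by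
      simp only [hB₁B₀ q.2 hq.2.1.le]
  -- time reversal and second extension
  set Br : ℝ → Π x : M, TangentSpace I x →L[ℝ] TangentSpace I x →L[ℝ] ℝ := fun s ↦ B₁ (T - s)
    with hBr
  have hflip : ContMDiff (I.prod 𝓘(ℝ, ℝ)) (I.prod 𝓘(ℝ, ℝ)) ∞ (fun q : M × ℝ ↦ (q.1, T - q.2)) :=
    contMDiff_fst.prodMk (((contDiff_const (c := T)).sub contDiff_id).comp_contMDiff contMDiff_snd)
  have hBrs : ContMDiffOn (I.prod 𝓘(ℝ, ℝ)) (I.prod 𝓘(ℝ, E →L[ℝ] E →L[ℝ] ℝ)) ∞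
      (fun q : M × ℝ ↦ TotalSpace.mk' (E →L[ℝ] E →L[ℝ] ℝ)
        (E := fun b : M ↦ TangentSpace I b →L[ℝ] TangentSpace I b →L[ℝ] ℝ) q.1 (Br q.2 q.1))
      (univ ×ˢ Ico 0 T) := by
    have hmaps : MapsTo (fun q : M × ℝ ↦ (q.1, T - q.2)) (univ ×ˢ Ico 0 T) (univ ×ˢ Ioc 0 T) := by
      rintro ⟨x, s⟩ ⟨-, hs⟩
      exact mk_mem_prod (mem_univ _) ⟨by linarith [hs.2], by linarith [hs.1]⟩
    exact hB₁s'.comp hflip.contMDiffOn hmaps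
  have hBrsymm : ∀ t x v w, Br t x v w = Br t x w v := fun t ↦ hB₁symm _
  set B₂ : ℝ → Π x : M, TangentSpace I x →L[ℝ] TangentSpace I x →L[ℝ] ℝ :=
    fun t ↦ timeExtendBilin T Br (T - t) with hB₂
  have hB₂B₁ : ∀ t, t ≤ T → B₂ t = B₁ t := by
    intro t ht
    funext x
    simp only [hB₂]
    rw [timeExtendBilin_of_nonneg Br (by linarith)]
    show B₁ (T - (T - t)) x = B₁ t x
    rw [show T - (T - t) = t by ring]
  refine ⟨B₂, ?_, fun t ht ↦ by rw [hB₂B₁ t ht.2, hB₁B₀ t ht.1], fun t x v w ↦ ?_⟩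
  · have h2 : ContMDiffOn (I.prod 𝓘(ℝ, ℝ)) (I.prod 𝓘(ℝ, E →L[ℝ] E →L[ℝ] ℝ)) ∞
        (fun q : M × ℝ ↦ TotalSpace.mk' (E →L[ℝ] E →L[ℝ] ℝ)
          (E := fun b : M ↦ TangentSpace I b →L[ℝ] TangentSpace I b →L[ℝ] ℝ) q.1 (B₂ q.2 q.1))
        (univ ×ˢ Ioi 0) := by
      have hmaps : MapsTo (fun q : M × ℝ ↦ (q.1, T - q.2)) (univ ×ˢ Ioi 0) (univ ×ˢ Iio T) := by
        rintro ⟨x, t⟩ ⟨-, ht⟩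
        have ht0 : 0 < t := ht
        exact mk_mem_prod (mem_univ _) (show T - t < T by linarith)
      exact (contMDiffOn_timeExtendBilin hT hBrs).comp hflip.contMDiffOn hmaps
    have h1 : ContMDiffOn (I.prod 𝓘(ℝ, ℝ)) (I.prod 𝓘(ℝ, E →L[ℝ] E →L[ℝ] ℝ)) ∞
        (fun q : M × ℝ ↦ TotalSpace.mk' (E →L[ℝ] E →L[ℝ] ℝ)
          (E := fun b : M ↦ TangentSpace I b →L[ℝ] TangentSpace I b →L[ℝ] ℝ) q.1 (B₂ q.2 q.1))
        (univ ×ˢ Iio T) :=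
      hB₁s.congr fun q hq ↦ by simp only [hB₂B₁ q.2 (le_of_lt hq.2)]
    rintro ⟨x, t⟩
    rcases lt_or_ge t T with ht | ht
    · exact (h1 (x, t) (mk_mem_prod (mem_univ _) ht)).contMDiffAt
        ((isOpen_univ.prod isOpen_Iio).mem_nhds (mk_mem_prod (mem_univ _) ht))
    · have ht' : t ∈ Ioi (0 : ℝ) := lt_of_lt_of_le hT ht
      exact (h2 (x, t) (mk_mem_prod (mem_univ _) ht')).contMDiffAt
        ((isOpen_univ.prod isOpen_Ioi).mem_nhds (mk_mem_prod (mem_univ _) ht'))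
  · simp only [hB₂]
    exact timeExtendBilin_symm hT hBrsymm _ _ _ _

omit [FiniteDimensional ℝ E] in
/-- The quadratic evaluation `(L, a) ↦ L a a` is continuous. [folklore] -/
theorem continuous_bilin_self_apply :
    Continuous fun p : (E →L[ℝ] E →L[ℝ] ℝ) × E ↦ p.1 p.2 p.2 := by
  have h1 : Continuous fun p : (E →L[ℝ] E →L[ℝ] ℝ) × E ↦ ((p.1 p.2, p.2) : (E →L[ℝ] ℝ) × E) :=
    (isBoundedBilinearMap_apply.continuous).prodMk continuous_snd
  exact (isBoundedBilinearMap_apply (𝕜 := ℝ) (E := E) (F := ℝ)).continuous.comp h1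

omit [FiniteDimensional ℝ E] [T2Space M] [CompactSpace M] in
/-- Times in `(-δ, T + δ)` are within `δ` of `[0, T]`. [folklore] -/
theorem infDist_Icc_lt_of_mem_Ioo {T δ t : ℝ} (hT : 0 ≤ T) (hδ : 0 < δ)
    (ht : t ∈ Ioo (-δ) (T + δ)) : Metric.infDist t (Icc 0 T) < δ := by
  rcases le_or_gt 0 t with h0 | h0
  · rcases le_or_gt t T with h1 | h1
    · have hmem : t ∈ Icc 0 T := ⟨h0, h1⟩
      rwa [Metric.infDist_zero_of_mem hmem]
    · calc Metric.infDist t (Icc 0 T) ≤ dist t T := Metric.infDist_le_dist_of_mem ⟨hT, le_rfl⟩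
        _ = t - T := by rw [Real.dist_eq, abs_of_pos (by linarith)]
        _ < δ := by linarith [ht.2]
  · calc Metric.infDist t (Icc 0 T) ≤ dist t 0 := Metric.infDist_le_dist_of_mem ⟨le_rfl, hT⟩
      _ = -t := by rw [Real.dist_eq, sub_zero, abs_of_neg h0]
      _ < δ := by linarith [ht.1]

omit [NormedSpace ℝ E] [I.Boundaryless] [FiniteDimensional ℝ E] [T2Space M] [CompactSpace M] in
/-- **Uniform positivity near a compact set** (pure topology): a function `g (x, t, a)` continuous
on `U × ℝ × E`, positive for `x` in a compact `K ⊆ U`, `t ∈ [0, T]` and `a` on a compact set `A`,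
stays positive for `t ∈ (-δ, T + δ)`, some `δ > 0` (the set where `g ≤ c / 2`, `c` the minimum,
is compact with time projection at positive distance from `[0, T]`). [folklore] -/
theorem exists_pos_forall_Ioo_pos {X : Type*} [TopologicalSpace X] [T2Space X] {K U : Set X}
    (hK : IsCompact K) (hKU : K ⊆ U) {A : Set E} (hA : IsCompact A) {T : ℝ} (hT : 0 ≤ T)
    {g : X × ℝ × E → ℝ} (hg : ContinuousOn g (U ×ˢ (univ : Set (ℝ × E))))
    (hpos : ∀ x ∈ K, ∀ t ∈ Icc 0 T, ∀ a ∈ A, 0 < g (x, t, a)) :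
    ∃ δ : ℝ, 0 < δ ∧ ∀ t ∈ Ioo (-δ) (T + δ), ∀ x ∈ K, ∀ a ∈ A, 0 < g (x, t, a) := by
  classical
  have hgK : ContinuousOn g (K ×ˢ (univ : Set (ℝ × E))) := hg.mono (prod_mono hKU le_rfl)
  set S : Set (X × ℝ × E) := K ×ˢ (Icc (-1) (T + 1) ×ˢ A) with hS
  have hSc : IsCompact S := hK.prod (isCompact_Icc.prod hA)
  set S₀ : Set (X × ℝ × E) := K ×ˢ (Icc 0 T ×ˢ A) with hS₀
  have hS₀c : IsCompact S₀ := hK.prod (isCompact_Icc.prod hA)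
  have hsub : ∀ A' : Set (ℝ × E), K ×ˢ A' ⊆ K ×ˢ (univ : Set (ℝ × E)) :=
    fun A' ↦ prod_mono le_rfl (subset_univ _)
  have hgpos : ∀ p ∈ S₀, 0 < g p := by
    rintro ⟨x, t, a⟩ ⟨hx, ht, ha⟩
    exact hpos x hx t ht a ha
  -- a positive lower bound on `S₀`
  obtain ⟨c, hc, hcle⟩ : ∃ c : ℝ, 0 < c ∧ ∀ p ∈ S₀, c ≤ g p := by
    rcases S₀.eq_empty_or_nonempty with he0 | hne
    · exact ⟨1, one_pos, fun p hp ↦ by rw [he0] at hp; exact hp.elim⟩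
    · obtain ⟨p₀, hp₀, hmin⟩ := hS₀c.exists_isMinOn hne (hgK.mono (hsub _))
      exact ⟨g p₀, hgpos p₀ hp₀, fun p hp ↦ hmin hp⟩
  -- the bad set and its time projection
  set Z : Set (X × ℝ × E) := S ∩ g ⁻¹' Iic (c / 2) with hZ
  have hZc : IsCompact Z :=
    hSc.of_isClosed_subset ((hgK.mono (hsub _)).preimage_isClosed_of_isClosed hSc.isClosed
      isClosed_Iic) inter_subset_left
  set tZ : Set ℝ := (fun p : X × ℝ × E ↦ p.2.1) '' Z with htZ
  have htZc : IsCompact tZ := hZc.image (continuous_fst.comp continuous_snd)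
  have htZdisj : ∀ t ∈ tZ, t ∉ Icc 0 T := by
    rintro _ ⟨⟨x, t, a⟩, ⟨⟨hx, -, ha⟩, hle⟩, rfl⟩ ht
    have := hcle (x, t, a) ⟨hx, ht, ha⟩
    simp only [mem_preimage, mem_Iic] at hle
    linarith
  obtain ⟨δ, hδ, hδ1, hδZ⟩ :
      ∃ δ : ℝ, 0 < δ ∧ δ ≤ 1 ∧ ∀ t ∈ tZ, δ ≤ Metric.infDist t (Icc 0 T) := by
    rcases tZ.eq_empty_or_nonempty with he0 | hne
    · exact ⟨1, one_pos, le_rfl, fun t ht ↦ by rw [he0] at ht; exact ht.elim⟩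
    · obtain ⟨t₀, ht₀, hmin⟩ := htZc.exists_isMinOn hne
        (Metric.continuous_infDist_pt (s := Icc (0 : ℝ) T)).continuousOn
      have hpos' : 0 < Metric.infDist t₀ (Icc 0 T) :=
        (isClosed_Icc.notMem_iff_infDist_pos ⟨0, le_rfl, hT⟩).1 (htZdisj t₀ ht₀)
      exact ⟨min (Metric.infDist t₀ (Icc 0 T)) 1, lt_min hpos' one_pos, min_le_right _ _,
        fun t ht ↦ (min_le_left _ _).trans (hmin ht)⟩
  refine ⟨δ, hδ, fun t ht x hx a ha ↦ ?_⟩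
  have htI : t ∈ Icc (-1) (T + 1) := ⟨by linarith [ht.1], by linarith [ht.2]⟩
  have htZ' : t ∉ tZ := fun h' ↦
    (lt_irrefl δ) ((hδZ t h').trans_lt (infDist_Icc_lt_of_mem_Ioo hT hδ ht))
  have hgood : c / 2 < g (x, t, a) := by
    by_contra hle
    exact htZ' ⟨(x, t, a), ⟨⟨hx, htI, ha⟩, not_lt.1 hle⟩, rfl⟩
  linarith

set_option maxSynthPendingDepth 2 in
omit [I.Boundaryless] [FiniteDimensional ℝ E] [T2Space M] [CompactSpace M] in
/-- The coordinate quadratic form `(x, t, a) ↦ B t x (e⁻¹ a) (e⁻¹ a)` of a smooth family of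
bilinear forms, in the tangent trivialization `e` at `x₁`, is continuous on
`(chart domain of x₁) × ℝ × E`. [folklore] -/
theorem continuousOn_coord_quadratic
    {B : ℝ → Π x : M, TangentSpace I x →L[ℝ] TangentSpace I x →L[ℝ] ℝ}
    (hB : ContMDiff (I.prod 𝓘(ℝ, ℝ)) (I.prod 𝓘(ℝ, E →L[ℝ] E →L[ℝ] ℝ)) ∞
      (fun q : M × ℝ ↦ TotalSpace.mk' (E →L[ℝ] E →L[ℝ] ℝ)
        (E := fun b : M ↦ TangentSpace I b →L[ℝ] TangentSpace I b →L[ℝ] ℝ) q.1 (B q.2 q.1)))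
    (x₁ : M) :
    ContinuousOn (fun p : M × ℝ × E ↦ B p.2.1 p.1
        ((trivializationAt E (TangentSpace I : M → Type _) x₁).symmL ℝ p.1 p.2.2)
        ((trivializationAt E (TangentSpace I : M → Type _) x₁).symmL ℝ p.1 p.2.2))
      ((chartAt H x₁).source ×ˢ (univ : Set (ℝ × E))) := by
  set eT := trivializationAt E (TangentSpace I : M → Type _) x₁ with heT
  set e := trivializationAt (E →L[ℝ] E →L[ℝ] ℝ)
    (fun b : M ↦ TangentSpace I b →L[ℝ] TangentSpace I b →L[ℝ] ℝ) x₁ with he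
  have hUe : ∀ y ∈ (chartAt H x₁).source, y ∈ e.baseSet := fun y hy ↦ by
    rw [he, hom_trivializationAt_baseSet, hom_trivializationAt_baseSet,
      TangentBundle.trivializationAt_baseSet]
    exact ⟨hy, hy, mem_univ _⟩
  have hUeT : ∀ y ∈ (chartAt H x₁).source, y ∈ eT.baseSet := fun y hy ↦ by
    rwa [heT, TangentBundle.trivializationAt_baseSet]
  obtain ⟨f, hf⟩ : ∃ f : M × ℝ → (E →L[ℝ] E →L[ℝ] ℝ), f = fun q ↦ (e ⟨q.1, B q.2 q.1⟩).2 :=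
    ⟨_, rfl⟩
  have hmaps : MapsTo (fun q : M × ℝ ↦ TotalSpace.mk' (E →L[ℝ] E →L[ℝ] ℝ)
      (E := fun b : M ↦ TangentSpace I b →L[ℝ] TangentSpace I b →L[ℝ] ℝ) q.1 (B q.2 q.1))
      ((chartAt H x₁).source ×ˢ (univ : Set ℝ)) e.source := fun q hq ↦ by
    rw [e.mem_source]; exact hUe q.1 hq.1
  have hfc : ContinuousOn f ((chartAt H x₁).source ×ˢ (univ : Set ℝ)) := by
    rw [hf]; exact (((e.contMDiffOn_iff hmaps).1 hB.contMDiffOn).2).continuousOn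
  have hfapply : ∀ x ∈ (chartAt H x₁).source, ∀ (t : ℝ) (a b : E),
      f (x, t) a b = B t x (eT.symmL ℝ x a) (eT.symmL ℝ x b) := by
    intro x hx t a b
    rw [hf]
    dsimp only
    rw [he, trivializationAt_bilin_snd x₁ (hUeT x hx) (B t x)]
    rfl
  have h1 : ContinuousOn (fun p : M × ℝ × E ↦ f (p.1, p.2.1))
      ((chartAt H x₁).source ×ˢ (univ : Set (ℝ × E))) :=
    hfc.comp (continuous_fst.prodMk (continuous_fst.comp continuous_snd)).continuousOn
      fun p hp ↦ ⟨hp.1, mem_univ _⟩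
  have h2 : ContinuousOn (fun p : M × ℝ × E ↦ ((f (p.1, p.2.1), p.2.2) : (E →L[ℝ] E →L[ℝ] ℝ) × E))
      ((chartAt H x₁).source ×ˢ (univ : Set (ℝ × E))) :=
    h1.prodMk (continuous_snd.comp continuous_snd).continuousOn
  refine (continuous_bilin_self_apply.comp_continuousOn h2).congr fun p hp ↦ ?_
  simp only [Function.comp_apply]
  exact (hfapply p.1 hp.1 p.2.1 p.2.2 p.2.2).symm

set_option maxSynthPendingDepth 2 in
omit [I.Boundaryless] in
/-- **Positive definiteness is an open condition along a smooth family of forms, locally on a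
compact manifold**: around each point `x₁` there are a neighbourhood `K` and `δ > 0` such that a
family `B` of bilinear forms on `TM`, `C^∞` on `M × ℝ` and positive definite for `t ∈ [0, T]`, is
positive definite on `K` for `t ∈ (-δ, T + δ)` (compactness of `K × [-1, T+1] ×` the model unit
sphere, in the trivialization at `x₁`). [folklore] -/
theorem exists_nhds_posDef_of_contMDiff {T : ℝ} (hT : 0 ≤ T)
    {B : ℝ → Π x : M, TangentSpace I x →L[ℝ] TangentSpace I x →L[ℝ] ℝ}
    (hB : ContMDiff (I.prod 𝓘(ℝ, ℝ)) (I.prod 𝓘(ℝ, E →L[ℝ] E →L[ℝ] ℝ)) ∞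
      (fun q : M × ℝ ↦ TotalSpace.mk' (E →L[ℝ] E →L[ℝ] ℝ)
        (E := fun b : M ↦ TangentSpace I b →L[ℝ] TangentSpace I b →L[ℝ] ℝ) q.1 (B q.2 q.1)))
    (hpos : ∀ t ∈ Icc 0 T, ∀ (x : M) (v : TangentSpace I x), v ≠ 0 → 0 < B t x v v) (x₁ : M) :
    ∃ K : Set M, K ∈ 𝓝 x₁ ∧ ∃ δ : ℝ, 0 < δ ∧
      ∀ t ∈ Ioo (-δ) (T + δ), ∀ x ∈ K, ∀ v : TangentSpace I x, v ≠ 0 → 0 < B t x v v := by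
  classical
  set eT := trivializationAt E (TangentSpace I : M → Type _) x₁ with heT
  have hUeT : ∀ y ∈ (chartAt H x₁).source, y ∈ eT.baseSet := fun y hy ↦ by
    rwa [heT, TangentBundle.trivializationAt_baseSet]
  -- a compact neighbourhood inside the chart domain
  obtain ⟨K, ⟨hKn, hKc⟩, hKsub⟩ := (compact_basis_nhds x₁).mem_iff.1
    ((chartAt H x₁).open_source.mem_nhds (mem_chart_source H x₁))
  -- the coordinate quadratic form
  obtain ⟨g, hg⟩ : ∃ g : M × ℝ × E → ℝ,
      g = fun p ↦ B p.2.1 p.1 (eT.symmL ℝ p.1 p.2.2) (eT.symmL ℝ p.1 p.2.2) := ⟨_, rfl⟩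
  have hgc : ContinuousOn g ((chartAt H x₁).source ×ˢ (univ : Set (ℝ × E))) := by
    rw [hg]; exact continuousOn_coord_quadratic hB x₁
  have hgpos : ∀ x ∈ K, ∀ t ∈ Icc 0 T, ∀ a ∈ Metric.sphere (0 : E) 1, 0 < g (x, t, a) := by
    intro x hx t ht a ha
    have hx' : x ∈ (chartAt H x₁).source := hKsub hx
    rw [hg]
    refine hpos t ht x _ fun h0 ↦ ?_
    have ha0 : a ≠ 0 := by
      intro h'; rw [h', mem_sphere_zero_iff_norm, norm_zero] at ha; exact zero_ne_one ha
    have : eT.continuousLinearMapAt ℝ x (eT.symmL ℝ x a) = a :=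
      eT.continuousLinearMapAt_symmL (hUeT x hx') a
    rw [h0, map_zero] at this
    exact ha0 this.symm
  obtain ⟨δ, hδ, hδpos⟩ := exists_pos_forall_Ioo_pos hKc hKsub (isCompact_sphere (0 : E) 1) hT
    hgc hgpos
  refine ⟨K, hKn, δ, hδ, fun t ht x hx v hv ↦ ?_⟩
  have hx' : x ∈ (chartAt H x₁).source := hKsub hx
  -- normalise the coordinate vector of `v`
  set a' : E := eT.continuousLinearMapAt ℝ x v with ha'
  have hva' : eT.symmL ℝ x a' = v := eT.symmL_continuousLinearMapAt (hUeT x hx') v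
  have ha'0 : a' ≠ 0 := fun h0 ↦ hv (by rw [← hva', h0, map_zero])
  have hna : 0 < ‖a'‖ := norm_pos_iff.2 ha'0
  set a : E := ‖a'‖⁻¹ • a' with ha
  have hasph : a ∈ Metric.sphere (0 : E) 1 := by
    rw [mem_sphere_zero_iff_norm, ha, norm_smul, norm_inv, norm_norm, inv_mul_cancel₀ hna.ne']
  have hgood : 0 < g (x, t, a) := hδpos t ht x hx a hasph
  -- `B t x v v = ‖a'‖² g (x, t, a)`
  have hv_eq : v = ‖a'‖ • eT.symmL ℝ x a := by
    rw [ha, map_smul, smul_smul, mul_inv_cancel₀ hna.ne', one_smul, hva']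
  have : B t x v v = ‖a'‖ ^ 2 * g (x, t, a) := by
    rw [hg, hv_eq]
    simp only [map_smul, _root_.smul_apply, smul_eq_mul]
    ring
  rw [this]
  positivity

set_option maxSynthPendingDepth 2 in
omit [I.Boundaryless] in
/-- **Positive definiteness along a smooth family on a compact manifold is an open condition in
time**: positive definite for `t ∈ [0, T]` implies positive definite for `t ∈ (-δ, T + δ)` for
some `δ > 0` (the local statement `exists_nhds_posDef_of_contMDiff` and a finite subcover).
[folklore] -/
theorem exists_pos_posDef_of_contMDiff {T : ℝ} (hT : 0 ≤ T)
    {B : ℝ → Π x : M, TangentSpace I x →L[ℝ] TangentSpace I x →L[ℝ] ℝ}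
    (hB : ContMDiff (I.prod 𝓘(ℝ, ℝ)) (I.prod 𝓘(ℝ, E →L[ℝ] E →L[ℝ] ℝ)) ∞
      (fun q : M × ℝ ↦ TotalSpace.mk' (E →L[ℝ] E →L[ℝ] ℝ)
        (E := fun b : M ↦ TangentSpace I b →L[ℝ] TangentSpace I b →L[ℝ] ℝ) q.1 (B q.2 q.1)))
    (hpos : ∀ t ∈ Icc 0 T, ∀ (x : M) (v : TangentSpace I x), v ≠ 0 → 0 < B t x v v) :
    ∃ δ : ℝ, 0 < δ ∧ ∀ t ∈ Ioo (-δ) (T + δ), ∀ (x : M) (v : TangentSpace I x), v ≠ 0 →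
      0 < B t x v v := by
  classical
  choose K hKn δ hδ hK using fun x₁ ↦ exists_nhds_posDef_of_contMDiff hT hB hpos x₁
  obtain ⟨t, -, ht⟩ := isCompact_univ.elim_nhds_subcover K fun x _ ↦ hKn x
  rcases t.eq_empty_or_nonempty with he | hne
  · refine ⟨1, one_pos, fun s _ x v hv ↦ ?_⟩
    have : x ∈ (⋃ y ∈ t, K y) := ht (mem_univ x)
    rw [he] at this; simp at this
  · refine ⟨t.inf' hne δ, (Finset.lt_inf'_iff hne).2 fun x _ ↦ hδ x, fun s hs x v hv ↦ ?_⟩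
    obtain ⟨y, hy, hxy⟩ := mem_iUnion₂.1 (ht (mem_univ x))
    have hδy : t.inf' hne δ ≤ δ y := Finset.inf'_le _ hy
    exact hK y s ⟨by linarith [hs.1], by linarith [hs.2]⟩ x hxy v hv

/-! #### The time cutoff -/

/-- A smooth cutoff equal to `1` on `[-δ/2, T + δ/2]` and to `0` off `(-δ, T + δ)`. [folklore] -/
def timeCutoff (δ T t : ℝ) : ℝ :=
  Real.smoothTransition (2 * t / δ + 2) * Real.smoothTransition (2 * (T - t) / δ + 2)

omit [NormedAddCommGroup E] [NormedSpace ℝ E] [TopologicalSpace H] [TopologicalSpace M]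
  [ChartedSpace H M] [IsManifold I ∞ M] [I.Boundaryless] [FiniteDimensional ℝ E] [T2Space M]
  [CompactSpace M] in
/-- The cutoff is smooth. [folklore] -/
theorem contDiff_timeCutoff (δ T : ℝ) : ContDiff ℝ ∞ (timeCutoff δ T) := by
  unfold timeCutoff
  exact (Real.smoothTransition.contDiff.comp (by fun_prop)).mul
    (Real.smoothTransition.contDiff.comp (by fun_prop))

omit [NormedAddCommGroup E] [NormedSpace ℝ E] [TopologicalSpace H] [TopologicalSpace M]
  [ChartedSpace H M] [IsManifold I ∞ M] [I.Boundaryless] [FiniteDimensional ℝ E] [T2Space M]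
  [CompactSpace M] in
/-- The cutoff takes values in `[0, 1]`. [folklore] -/
theorem timeCutoff_mem_Icc (δ T t : ℝ) : timeCutoff δ T t ∈ Icc 0 1 :=
  ⟨mul_nonneg (Real.smoothTransition.nonneg _) (Real.smoothTransition.nonneg _),
    mul_le_one₀ (Real.smoothTransition.le_one _) (Real.smoothTransition.nonneg _)
      (Real.smoothTransition.le_one _)⟩

omit [NormedAddCommGroup E] [NormedSpace ℝ E] [TopologicalSpace H] [TopologicalSpace M]
  [ChartedSpace H M] [IsManifold I ∞ M] [I.Boundaryless] [FiniteDimensional ℝ E] [T2Space M]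
  [CompactSpace M] in
/-- The cutoff is `1` on `[0, T]`. [folklore] -/
theorem timeCutoff_eq_one {δ T t : ℝ} (hδ : 0 < δ) (ht : t ∈ Icc 0 T) : timeCutoff δ T t = 1 := by
  unfold timeCutoff
  rw [Real.smoothTransition.one_of_one_le, Real.smoothTransition.one_of_one_le, one_mul]
  · have : 0 ≤ 2 * (T - t) / δ := div_nonneg (by linarith [ht.2]) hδ.le
    linarith
  · have : 0 ≤ 2 * t / δ := div_nonneg (by linarith [ht.1]) hδ.le
    linarith

omit [NormedAddCommGroup E] [NormedSpace ℝ E] [TopologicalSpace H] [TopologicalSpace M]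
  [ChartedSpace H M] [IsManifold I ∞ M] [I.Boundaryless] [FiniteDimensional ℝ E] [T2Space M]
  [CompactSpace M] in
/-- The cutoff vanishes off `(-δ, T + δ)`. [folklore] -/
theorem timeCutoff_eq_zero {δ T t : ℝ} (hδ : 0 < δ) (ht : t ∉ Ioo (-δ) (T + δ)) :
    timeCutoff δ T t = 0 := by
  unfold timeCutoff
  rcases le_or_gt t (-δ) with h1 | h1
  · rw [Real.smoothTransition.zero_of_nonpos, zero_mul]
    have : 2 * t / δ ≤ -2 := by rw [div_le_iff₀ hδ]; linarith
    linarith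
  · have h2 : T + δ ≤ t := by
      by_contra h2; exact ht ⟨h1, not_le.1 h2⟩
    rw [mul_comm, Real.smoothTransition.zero_of_nonpos, zero_mul]
    have : 2 * (T - t) / δ ≤ -2 := by rw [div_le_iff₀ hδ]; linarith
    linarith

/-! #### The extension theorem -/

set_option maxSynthPendingDepth 2 in
/-- **Smooth extension in time of a smooth family of Riemannian metrics on a compact manifold.**
A family `h` of Riemannian metrics, `C^∞` on `M × [0, T]` (one-sided in time at the endpoints),
is the restriction of a family `h'` of Riemannian metrics `C^∞` on all of `M × ℝ`: extend the
bilinear forms by Seeley's operator across both endpoints (`exists_contMDiff_timeExtension_bilin`),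
keep positivity for `t ∈ (-δ, T + δ)` (`exists_pos_posDef_of_contMDiff`) and blend with the fixed
metric `h 0` through a time cutoff. [cite: Seeley1964, Theorem] -/
theorem exists_isContMDiffFamilyOn_extension {T : ℝ} (hT : 0 < T)
    {h : ℝ → PseudoRiemannianMetric I ∞ E (TangentSpace I : M → Type _)}
    (hh : IsContMDiffFamilyOn ∞ h (Icc 0 T)) (hR : ∀ s ∈ Icc 0 T, (h s).IsRiemannian) :
    ∃ h' : ℝ → PseudoRiemannianMetric I ∞ E (TangentSpace I : M → Type _),
      IsContMDiffFamilyOn ∞ h' univ ∧ (∀ s, (h' s).IsRiemannian) ∧ ∀ s ∈ Icc 0 T, h' s = h s := by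
  obtain ⟨B, hBs, hBh, hBsymm⟩ := exists_contMDiff_timeExtension_bilin hT hh
  have hposT : ∀ t ∈ Icc 0 T, ∀ (x : M) (v : TangentSpace I x), v ≠ 0 → 0 < B t x v v := by
    intro t ht x v hv
    rw [hBh t ht]
    exact hR t ht x v hv
  obtain ⟨δ, hδ, hpos⟩ := exists_pos_posDef_of_contMDiff hT.le hBs hposT
  set χ := timeCutoff δ T with hχ
  have hR0 : (h 0).IsRiemannian := hR 0 ⟨le_rfl, hT.le⟩
  -- positivity of the blended forms
  have hposblend : ∀ (t : ℝ) (x : M) (v : TangentSpace I x), v ≠ 0 →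
      0 < (χ t • B t x + (1 - χ t) • (h 0).val x) v v := by
    intro t x v hv
    simp only [_root_.add_apply, _root_.smul_apply, smul_eq_mul]
    have h01 := timeCutoff_mem_Icc δ T t
    have h0v := hR0 x v hv
    by_cases ht : t ∈ Ioo (-δ) (T + δ)
    · have hBv := hpos t ht x v hv
      rcases h01.1.eq_or_lt with h0 | h0
      · rw [hχ, ← h0]; simpa using h0v
      · have : 0 ≤ (1 - χ t) * (h 0).val x v v := mul_nonneg (by linarith [h01.2]) h0v.le
        nlinarith
    · rw [hχ, timeCutoff_eq_zero hδ ht]; simpa using h0v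
  -- smoothness of the blended section on `M × ℝ`
  have hsmooth : ContMDiff (I.prod 𝓘(ℝ, ℝ)) (I.prod 𝓘(ℝ, E →L[ℝ] E →L[ℝ] ℝ)) ∞
      (fun q : M × ℝ ↦ TotalSpace.mk' (E →L[ℝ] E →L[ℝ] ℝ)
        (E := fun b : M ↦ TangentSpace I b →L[ℝ] TangentSpace I b →L[ℝ] ℝ) q.1
          (χ q.2 • B q.2 q.1 + (1 - χ q.2) • (h 0).val q.1)) := by
    intro q
    have hc : ContMDiff (I.prod 𝓘(ℝ, ℝ)) 𝓘(ℝ, ℝ) ∞ fun q : M × ℝ ↦ χ q.2 :=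
      (contDiff_timeCutoff δ T).comp_contMDiff contMDiff_snd
    have hc' : ContMDiff (I.prod 𝓘(ℝ, ℝ)) 𝓘(ℝ, ℝ) ∞ fun q : M × ℝ ↦ 1 - χ q.2 :=
      contMDiff_const.sub hc
    have hW : ContMDiff (I.prod 𝓘(ℝ, ℝ)) (I.prod 𝓘(ℝ, E →L[ℝ] E →L[ℝ] ℝ)) ∞
        (fun q : M × ℝ ↦ TotalSpace.mk' (E →L[ℝ] E →L[ℝ] ℝ)
          (E := fun b : M ↦ TangentSpace I b →L[ℝ] TangentSpace I b →L[ℝ] ℝ) q.1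
            ((h 0).val q.1)) := (h 0).contMDiff.comp contMDiff_fst
    exact (ContMDiffWithinAt.linear_comb_bilinSection (b := Prod.fst) (hc q).contMDiffWithinAt
      (hc' q).contMDiffWithinAt (hBs q).contMDiffWithinAt (hW q).contMDiffWithinAt).contMDiffAt
      univ_mem
  refine ⟨fun t ↦
    { val := fun x ↦ χ t • B t x + (1 - χ t) • (h 0).val x
      symm := fun x v w ↦ by
        simp only [_root_.add_apply, _root_.smul_apply, hBsymm t x v w, (h 0).symm x v w]
      nondegenerate := fun x v hv ↦ by
        by_contra h0
        exact (hposblend t x v h0).ne' (hv v)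
      contMDiff := fun x ↦ (hsmooth (x, t)).comp x
        (contMDiffAt_id.prodMk contMDiffAt_const) }, ?_, fun s x v hv ↦ hposblend s x v hv,
    fun s hs ↦ ?_⟩
  · exact hsmooth.contMDiffOn
  · refine PseudoRiemannianMetric.ext (funext fun x ↦ ?_)
    dsimp only
    rw [hχ, timeCutoff_eq_one hδ hs, hBh s hs, sub_self]
    ext v w
    simp only [_root_.add_apply, _root_.smul_apply, smul_eq_mul, one_mul, zero_mul, add_zero]

end Metric

end Literature.Geometry.Riemannian
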